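import Summits.CriticalPhenomena.Ising3DConformalLimit.Theorems.PerfectScreeningCoulombImpliesNontrivialOfLeeYangGap
import Summits.CriticalPhenomena.Ising3DConformalLimit.Theorems.PerfectScreeningCoulombImpliesNontrivialGapOfBinder
import Summits.CriticalPhenomena.Ising3DConformalLimit.Theorems.LeeYangGapGaussianLimitKillsBlockCoupling
import Summits.CriticalPhenomena.Ising3DConformalLimit.Theses.LatticeSDPCertificates

/-!
# Strategy census `s4` (independent, family `s`) for crux `NearCriticalLeeYangGap`
# (stmt-CriticalPhenomena-4945, route `LeeYangGap`) — typed companion of `STRATEGY-CENSUS-s4.md`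

Every object named in the census is typed here over existing declarations, and every implication
the census calls "trivial" or "provable now" is proved (no `sorry`).  Nothing here is a new route
item; the file documents why each switch (weaker intermediate / decomposition / transfer /
strengthen / negation) lands on an existing open crux of at least the same strength.

* `gap_iff_binderNonvanishing` : GAP ⟺ `g_L(β_c) ↛ 0` (tree theorems, by name).
* weaker intermediate: `NonGaussianMoebiusLimit` (W_Möb), `summit_of_nonGaussianMoebiusLimit`,
  `nonGaussianMoebiusLimit_of_nonGaussianLimit` (0636 ⟹ W_Möb),
  `nonGaussianScaleCovLimit_of_gap` (GAP ⟹ W_sc ⟹ W_Möb, via item 4950).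
* decomposition: `WindowForcesGap`, `gap_of_window_split` (the bridge split; trivial seam).
* transfer (d = 2 ⟶ d = 3 entrance as it stands in the tree): `gap_of_coulombFloor_upperIsotherm`.
* strengthen: `DoublingInstability` (S⁺_RG) and `binderNonvanishing_of_doublingInstability`.
* negation: `not_gap_iff_binderVanishing`.
-/

namespace Summit.CriticalPhenomena.Ising3DConformalLimit.Cruxes.NearCriticalLeeYangGap.CensusS4

open Filter Topology Literature.Probability.LatticeModels
open Summit.CriticalPhenomena.Ising3DConformalLimit

/-- The crux, by name. -/
abbrev GAP : Prop := Theses.LeeYangGap.NearCriticalLeeYangGap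

/-- `Σ_L = ⟨M_L²⟩⁺_{β_c}`, block variance of `M_L = Σ_{x ∈ box 3 L} σ_x` in the infinite-volume
plus state at `β_c`. -/
noncomputable def blockVar (L : ℕ) : ℝ :=
  plusExpect 3 (criticalBeta 3) 0 (fun σ => (∑ x ∈ box 3 L, spinAt x σ) ^ 2)

/-- `⟨M_L⁴⟩⁺_{β_c}`. -/
noncomputable def blockM4 (L : ℕ) : ℝ :=
  plusExpect 3 (criticalBeta 3) 0 (fun σ => (∑ x ∈ box 3 L, spinAt x σ) ^ 4)

/-- The block Binder coupling `g_L = (3Σ_L² − ⟨M_L⁴⟩)/Σ_L² = −U₄(M_L)/Σ_L²` at `β_c`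
(the quantity of item 4950). -/
noncomputable def binder (L : ℕ) : ℝ := (3 * blockVar L ^ 2 - blockM4 L) / blockVar L ^ 2

/-- `g_L ↛ 0`, i.e. `limsup_L g_L(β_c) > 0` (all `g_L ≥ 0` by Lebowitz/Newman). -/
def BinderNonvanishing : Prop := ¬ Tendsto binder atTop (𝓝 0)

/-- **GAP is the lattice clause (iii) at block level**: GAP ⟺ `g_L(β_c) ↛ 0`.
Both directions are tree theorems (Newman's `12/θ₁⁴ ≤ −U₄(M_L)`, CJN antitonicity 4947/4948 for ⟹;
`θ₁ = arcsin(b_max^{-1/2})`, `θ₁²Σ_L ≤ 3π²/(2 g_L)`-type bound for ⟸). -/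
theorem gap_iff_binderNonvanishing : GAP ↔ BinderNonvanishing :=
  ⟨fun h => PerfectScreeningCoulombImpliesNontrivial.sketchPub_binderNonvanishing_of_nearCriticalLeeYangGap h,
   fun h => PerfectScreeningCoulombImpliesNontrivial.stub_gapOfBinderNonvanishing h⟩

/-! ## Weaker intermediate (from the summit) -/

/-- `W_Möb`: every Möbius-covariant non-degenerate pointwise scaling limit of the critical `ℤ³`
correlations has `U₄ ≢ 0`.  This is the WEAKEST statement that can replace GAP in the route's
`closes` (whose other live binder is `MoebiusLimitExists`, item 1344): see
`summit_of_nonGaussianMoebiusLimit` and, conversely, any `X` with `X → MoebiusLimitExists → S`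
gives `X → W_Möb` pointwise in the limit witness. -/
def NonGaussianMoebiusLimit : Prop :=
  ∀ (ρ : ℝ → ℝ) (Δ : ℝ) (S : CorrFamily 3), (∀ δ ∈ Set.Ioc (0:ℝ) 1, 0 < ρ δ) → 0 < Δ →
    HasPointwiseScalingLimit (criticalCorr 3) ρ S → IsNondegenerateTwoPoint S →
    IsMoebiusCovariant Δ S → HasNontrivialU4 S

/-- `W_sc`: the same with Möbius covariance weakened to scale covariance (the form item 4950 uses). -/
def NonGaussianScaleCovLimit : Prop :=
  ∀ (ρ : ℝ → ℝ) (Δ : ℝ) (S : CorrFamily 3), (∀ δ ∈ Set.Ioc (0:ℝ) 1, 0 < ρ δ) →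
    HasPointwiseScalingLimit (criticalCorr 3) ρ S → IsNondegenerateTwoPoint S →
    IsScaleCovariant Δ S → HasNontrivialU4 S

/-- `W₀` = the signature of item 0636 (`IsingEuclidUpgradeR4NonGaussian` / `NonGaussianLimit`,
verbatim): every non-degenerate pointwise limit is non-Gaussian. -/
def NonGaussianLimit : Prop :=
  ∀ (ρ : ℝ → ℝ) (S : CorrFamily 3), (∀ δ ∈ Set.Ioc (0:ℝ) 1, 0 < ρ δ) →
    HasPointwiseScalingLimit (criticalCorr 3) ρ S → IsNondegenerateTwoPoint S → HasNontrivialU4 S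

/-- `W_Möb` closes the summit given the route's residual `MoebiusLimitExists` (item 1344). -/
theorem summit_of_nonGaussianMoebiusLimit (hW : NonGaussianMoebiusLimit)
    (hM : Theses.LeeYangGap.MoebiusLimitExists) : _root_.Ising3DConformalLimit := by
  obtain ⟨ρ, Δ, S, hρ, hΔ, hlim, hnd, hMoeb⟩ := hM
  exact ⟨ρ, Δ, S, hρ, hΔ, hlim, hnd, hMoeb, hW ρ Δ S hρ hΔ hlim hnd hMoeb⟩

/-- `W₀ ⟹ W_sc ⟹ W_Möb` (trivial weakenings). -/
theorem nonGaussianScaleCovLimit_of_nonGaussianLimit (h : NonGaussianLimit) :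
    NonGaussianScaleCovLimit := fun ρ _ S hρ hlim hnd _ => h ρ S hρ hlim hnd

theorem nonGaussianMoebiusLimit_of_nonGaussianScaleCovLimit (h : NonGaussianScaleCovLimit) :
    NonGaussianMoebiusLimit := fun ρ Δ S hρ _ hlim hnd hM => h ρ Δ S hρ hlim hnd hM.isScaleCovariant

/-- **GAP ⟹ W_sc** (hence GAP ⟹ W_Möb): item 4950 (`gaussianLimitKillsBlockCoupling_proof`,
PROVED) says a Gaussian scale-covariant non-degenerate limit forces `g_L → 0`. So GAP sits ABOVE
the weakest admissible replacement; the census explains why no typed why-easier separates them. -/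
theorem nonGaussianScaleCovLimit_of_gap (hgap : GAP) : NonGaussianScaleCovLimit := by
  intro ρ Δ S hρ hlim hnd hsc
  by_contra hU4
  exact (gap_iff_binderNonvanishing.1 hgap)
    (LeeYangGapGaussianLimitKillsBlockCoupling.gaussianLimitKillsBlockCoupling_proof ρ Δ S hρ hlim hnd hsc hU4)

theorem nonGaussianMoebiusLimit_of_gap (hgap : GAP) : NonGaussianMoebiusLimit :=
  nonGaussianMoebiusLimit_of_nonGaussianScaleCovLimit (nonGaussianScaleCovLimit_of_gap hgap)

/-! ## Decomposition (best typed split: the η-window bridge) -/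

/-- Second piece of the bridge split: the η-window (`G(ne₁)/G(me₁) ≥ c (n/m)^{-(3/2-ε)}`, i.e.
`η ≤ 1/2 - ε` in doubling form; item 5507 `WindowBelowHalf`, open) forces the block Lee–Yang gap.
It is `LatticeSDPCertificates.WindowForcesU4` (item 5505, open crux) in lattice dress. -/
def WindowForcesGap : Prop := Theses.LatticeSDPCertificates.WindowBelowHalf → GAP

/-- The split's assembly (a one-line seam, flag `trivial_seam`). -/
theorem gap_of_window_split (hW : Theses.LatticeSDPCertificates.WindowBelowHalf)
    (hF : WindowForcesGap) : GAP := hF hW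

/-! ## Transfer (the d = 2 mechanism's d = 3 entrance, as it stands in the tree) -/

/-- The Camia–Garban–Newman mechanism (free energy in a field at the CLT scale) enters GAP on `ℤ³`
through an UPPER CRITICAL ISOTHERM; the tree's typed entrance (PerfectScreening, PROVED glue):
a Coulomb floor `c/‖x‖ ≤ G_c(x)` plus `m(β_c,h) ≤ A h^{1/5}` frequently as `h ↓ 0` give GAP.
Both hypotheses are δ-hyperscaling-strength inputs (PerfectScreening residual S6, item 13885). -/
theorem gap_of_coulombFloor_upperIsotherm
    (hC : ∃ c : ℝ, 0 < c ∧ ∀ x : Site 3, x ≠ 0 → c / ‖x‖ ≤ criticalTwoPoint 3 x)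
    (hR : ∃ A : ℝ, ∃ᶠ h in 𝓝[>] (0:ℝ), magnetizationInField 3 (criticalBeta 3) h ≤ A * h ^ ((1:ℝ) / 5)) :
    GAP :=
  PerfectScreeningCoulombImpliesNontrivial.nearCriticalLeeYangGap_of_upperIsothermFrequently hC hR

/-! ## Strengthen: instability of the Gaussian fixed point under block doubling (S⁺_RG) -/

/-- `S⁺_RG`: once the block coupling is small it does not decrease under doubling of the block.
(Wilson–Kadanoff picture: the Gaussian fixed point is unstable in `d = 3`, relevant eigenvalue
`L^{4-d-2η} = 2^{1-2η} > 1`; a rigorous version needs `η < 1/2` AND a non-perturbative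
position-space RG at strong coupling.) -/
def DoublingInstability : Prop :=
  ∃ ε : ℝ, 0 < ε ∧ ∃ L₀ : ℕ, ∀ L : ℕ, L₀ ≤ L → binder L ≤ ε → binder L ≤ binder (2 * L)

/-- `S⁺_RG` plus strict positivity of `g_L` (routine: `M_L` is a bounded non-constant Lee–Yang
variable, so `U₄(M_L) < 0`) gives `g_L ↛ 0`, hence GAP by `gap_iff_binderNonvanishing`. -/
theorem binderNonvanishing_of_doublingInstability (hI : DoublingInstability)
    (hpos : ∀ L : ℕ, 1 ≤ L → 0 < binder L) : BinderNonvanishing := by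
  intro hlim
  obtain ⟨ε, hε, L₀, hstep⟩ := hI
  obtain ⟨L₁, hL₁⟩ := eventually_atTop.1 ((tendsto_order.1 hlim).2 ε hε)
  set N : ℕ := max (max L₀ L₁) 1 with hN
  have hN0 : L₀ ≤ N := le_trans (le_max_left _ _) (le_max_left _ _)
  have hN1 : L₁ ≤ N := le_trans (le_max_right _ _) (le_max_left _ _)
  have hNpos : 1 ≤ N := le_max_right _ _
  have hpowpos : ∀ k : ℕ, 1 ≤ 2 ^ k := fun k => Nat.one_le_two_pow
  -- along the doubling sequence `2^k N` the coupling never drops below `binder N`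
  have hmono : ∀ k : ℕ, binder N ≤ binder (2 ^ k * N) := by
    intro k
    induction k with
    | zero => simp
    | succ k ih =>
      have hk0 : L₀ ≤ 2 ^ k * N := le_trans hN0 (Nat.le_mul_of_pos_left N (hpowpos k))
      have hk1 : L₁ ≤ 2 ^ k * N := le_trans hN1 (Nat.le_mul_of_pos_left N (hpowpos k))
      have hsmall : binder (2 ^ k * N) ≤ ε := (hL₁ _ hk1).le
      calc binder N ≤ binder (2 ^ k * N) := ih
        _ ≤ binder (2 * (2 ^ k * N)) := hstep _ hk0 hsmall
        _ = binder (2 ^ (k + 1) * N) := by congr 1; ring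
  -- but `binder (2^k N) → 0` along `k → ∞` while `binder N > 0`
  have hkle : ∀ k : ℕ, k ≤ 2 ^ k * N := by
    intro k
    have h1 : k ≤ 2 ^ k := by
      induction k with
      | zero => simp
      | succ k ih =>
        have h2 : 1 ≤ 2 ^ k := hpowpos k
        rw [pow_succ]
        generalize 2 ^ k = t at ih h2 ⊢
        omega
    exact le_trans h1 (Nat.le_mul_of_pos_right _ hNpos)
  have hsub : Tendsto (fun k : ℕ => 2 ^ k * N) atTop atTop :=
    tendsto_atTop_mono hkle tendsto_id
  have hb0 : 0 < binder N := hpos N hNpos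
  obtain ⟨k, hk⟩ := ((tendsto_order.1 (hlim.comp hsub)).2 _ hb0).exists
  exact absurd (hmono k) (not_le.2 hk)

/-- Hence `S⁺_RG ∧ (g_L > 0) ⟹ GAP`. -/
theorem gap_of_doublingInstability (hI : DoublingInstability) (hpos : ∀ L : ℕ, 1 ≤ L → 0 < binder L) :
    GAP :=
  gap_iff_binderNonvanishing.2 (binderNonvanishing_of_doublingInstability hI hpos)

/-! ## Negation -/

/-- A counterexample to GAP is exactly the Gaussian scenario `g_L(β_c) → 0` for the n.n. model
(realised by the `α < 3/2` long-range members of `LongRangeTrivialityOnZ3`, never by a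
finite-range model in `d = 3` as far as anyone knows; numerically `g_L → 0.85`). -/
theorem not_gap_iff_binderVanishing : ¬ GAP ↔ Tendsto binder atTop (𝓝 0) := by
  rw [gap_iff_binderNonvanishing]
  exact not_not

end Summit.CriticalPhenomena.Ising3DConformalLimit.Cruxes.NearCriticalLeeYangGap.CensusS4
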